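import Summits.CriticalPhenomena.PercolationContinuityZ3.Theorems.PercNearOneGluingNoHeavyLowerTailAPLShortcutParallel
import HarnessLib

/-!
# `NoHeavyLowerTail` (stmt-CriticalPhenomena-4575) — TWO-SIDED PARALLEL COMPOSITION I: Harris closure at the cell level and the
`Z`-fibre monotonicity of `E` (two-sided extremal reduction)

Support file (prover prim-ineq-gen-8 gen 60; `--supports stmt-CriticalPhenomena-4575`; memo
run/shared/lean/prim/prim-ineq-gen-8/FINDING-gen60-TWOSIDED.md).  No definitions, no named facts, no sorries.

Setting (memos gen 58 §0(2), gen 59 §3; files `…APLGluedCells`, `…APLShortcutParallel`, `…APLSeriesReduction`).  A three-point piece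
`(o; u, v)` is its cell vector `(x₀, B, A, m, τ) = (P(o|u|v), P(ou|v), P(ov|u), P(o|uv), P(ouv))` (sum `1`); `p = τ + B = P(o↔u)`,
`π = τ + A`, `κ = (x₀ + m)τ − AB` (`= τ − pπ` when the cells sum to `1`), `E = κ²/(pπm)`, `C = 28/27`.  The parallel composition
(3-terminal union at `o, u, v`, `glued_cell_*`) of pieces `x` and `y` has the cells
`z₀ = x₀y₀`, `z_B = x₀B′ + By₀ + BB′`, `z_A = x₀A′ + Ay₀ + AA′`, `z_m = x₀m′ + my₀ + mm′`,
`z_τ = τ(y₀+B′+A′+m′+τ′) + (x₀+B+A+m)τ′ + B(A′+m′) + A(B′+m′) + m(B′+A′)`;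
equivalently the isolation coordinates `(Z, O, U, W) = (x₀, x₀+m, x₀+A, x₀+B)` multiply.  The open problem U(28/27) of the memos is:
`E ≤ C` for `x` and `y` ⟹ `E ≤ C` for the composite.  This file proves the structural reductions found in gen 60:
* `comp_kappa_eq`, `comp_harris` — `κ_z = U_yW_y·κ_x + U_xW_x·κ_y + κ_xκ_y + Q` with `Q` a polynomial with non-negative coefficients in
  the ten cells: Harris (`κ ≥ 0`) is closed under composition at the cell level.
* `fiber_mono`, `fiber_le` — on a fibre `{O, U, W fixed}` (raise `Z = x₀` by `δ`, i.e. `(x₀+δ, B−δ, A−δ, m−δ, τ+2δ)`) `E` is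
  non-decreasing as long as `κ ≥ 0`: `κ/p`, `κ/π` and `1/m` all increase.  Hence (`comp_raise_le`) U(C) needs to be checked only for
  `Z`-extremal pieces (`E = C`, or a cap `A = 0` / `B = 0`), since the composite of the raised pieces is the raise of the composite.
The sequel file `…APLTwoSidedHarrisTight.lean` uses these to prove that `E ≤ 28/27` is preserved under composition with any
Harris-tight piece (`κ_y = 0`). [this work]
-/

namespace Summit.CriticalPhenomena.PercolationContinuityZ3.Theorems

namespace APL

/-- **Composite covariance identity.**  For the 3-terminal union of pieces `x = (x₀,B,A,m,τ)` and `y = (y₀,B′,A′,m′,τ′)`: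
`κ_z = (y₀+A′)(y₀+B′)·κ_x + (x₀+A)(x₀+B)·κ_y + κ_xκ_y + Q` with `κ_x = (x₀+m)τ − AB`, `κ_y = (y₀+m′)τ′ − A′B′` and `Q` the displayed
polynomial with non-negative coefficients (every monomial of `Q` contains `m` or `m′`: the `u–v` links are what helps the apex). [this work] -/
theorem comp_kappa_eq (x0 B A m τ y0 B' A' m' τ' : ℝ) :
    (x0 * y0 + (x0 * m' + m * y0 + m * m'))
        * (τ * (y0 + B' + A' + m' + τ') + (x0 + B + A + m) * τ' + B * (A' + m') + A * (B' + m') + m * (B' + A'))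
      - (x0 * A' + A * y0 + A * A') * (x0 * B' + B * y0 + B * B')
    = (y0 + A') * (y0 + B') * ((x0 + m) * τ - A * B) + (x0 + A) * (x0 + B) * ((y0 + m') * τ' - A' * B')
      + ((x0 + m) * τ - A * B) * ((y0 + m') * τ' - A' * B')
      + (m * τ * m' * m' + m * τ * A' * m' + m * τ * B' * m' + 2 * m * τ * y0 * m' + m * m * m' * τ' + m * m * A' * m'
        + m * m * B' * m' + m * m * y0 * τ' + m * m * y0 * A' + m * m * y0 * B' + A * m * m' * τ' + A * m * m' * m'
        + A * m * B' * m' + A * m * y0 * τ' + A * m * y0 * m' + A * m * y0 * B' + B * m * m' * τ' + B * m * m' * m'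
        + B * m * A' * m' + B * m * y0 * τ' + B * m * y0 * m' + B * m * y0 * A' + x0 * τ * m' * m' + x0 * τ * A' * m'
        + x0 * τ * B' * m' + 2 * x0 * τ * y0 * m' + 2 * x0 * m * m' * τ' + x0 * m * A' * m' + x0 * m * B' * m'
        + 2 * x0 * m * y0 * τ' + x0 * m * y0 * A' + x0 * m * y0 * B' + x0 * A * m' * m' + x0 * A * B' * m' + x0 * A * y0 * m'
        + x0 * B * m' * m' + x0 * B * A' * m' + x0 * B * y0 * m') := by
  ring

/-- **Harris is closed under parallel composition (cell level).**  If all ten cells are `≥ 0` and `κ_x, κ_y ≥ 0` then the composite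
covariance `κ_z ≥ 0` — indeed `κ_z ≥ (y₀+A′)(y₀+B′)κ_x + (x₀+A)(x₀+B)κ_y + κ_xκ_y`. [this work] -/
theorem comp_harris (x0 B A m τ y0 B' A' m' τ' : ℝ) (h0 : 0 ≤ x0) (hB : 0 ≤ B) (hA : 0 ≤ A) (hm : 0 ≤ m) (hτ : 0 ≤ τ)
    (h0' : 0 ≤ y0) (hB' : 0 ≤ B') (hA' : 0 ≤ A') (hm' : 0 ≤ m') (hτ' : 0 ≤ τ')
    (hκ : 0 ≤ (x0 + m) * τ - A * B) (hκ' : 0 ≤ (y0 + m') * τ' - A' * B') :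
    0 ≤ (x0 * y0 + (x0 * m' + m * y0 + m * m'))
        * (τ * (y0 + B' + A' + m' + τ') + (x0 + B + A + m) * τ' + B * (A' + m') + A * (B' + m') + m * (B' + A'))
      - (x0 * A' + A * y0 + A * A') * (x0 * B' + B * y0 + B * B') := by
  rw [comp_kappa_eq]
  have h1 : 0 ≤ (y0 + A') * (y0 + B') * ((x0 + m) * τ - A * B) := by positivity
  have h2 : 0 ≤ (x0 + A) * (x0 + B) * ((y0 + m') * τ' - A' * B') := by positivity
  have h3 : 0 ≤ ((x0 + m) * τ - A * B) * ((y0 + m') * τ' - A' * B') := mul_nonneg hκ hκ'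
  have h4 : 0 ≤ m * τ * m' * m' + m * τ * A' * m' + m * τ * B' * m' + 2 * m * τ * y0 * m' + m * m * m' * τ' + m * m * A' * m'
        + m * m * B' * m' + m * m * y0 * τ' + m * m * y0 * A' + m * m * y0 * B' + A * m * m' * τ' + A * m * m' * m'
        + A * m * B' * m' + A * m * y0 * τ' + A * m * y0 * m' + A * m * y0 * B' + B * m * m' * τ' + B * m * m' * m'
        + B * m * A' * m' + B * m * y0 * τ' + B * m * y0 * m' + B * m * y0 * A' + x0 * τ * m' * m' + x0 * τ * A' * m'
        + x0 * τ * B' * m' + 2 * x0 * τ * y0 * m' + 2 * x0 * m * m' * τ' + x0 * m * A' * m' + x0 * m * B' * m'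
        + 2 * x0 * m * y0 * τ' + x0 * m * y0 * A' + x0 * m * y0 * B' + x0 * A * m' * m' + x0 * A * B' * m' + x0 * A * y0 * m'
        + x0 * B * m' * m' + x0 * B * A' * m' + x0 * B * y0 * m' := by positivity
  linarith

/-- **`Z`-fibre monotonicity of `E`.**  Raising `Z = x₀` by `δ ∈ [0, m]` at fixed `O = x₀+m`, `U = x₀+A`, `W = x₀+B`
(cells `(x₀+δ, B−δ, A−δ, m−δ, τ+2δ)`) does not decrease `E = κ²/(pπm)` when `κ ≥ 0`; division-free:
`κ²·p̃π̃m̃ ≤ κ̃²·pπm` with `p̃ = p + δ`, `π̃ = π + δ`, `m̃ = m − δ`, `κ̃ = (x₀+m)(τ+2δ) − (A−δ)(B−δ)`.  (Because `κ ≤ p(O+B)`,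
`κ ≤ π(O+A)`, the ratios `κ/p`, `κ/π` increase with `Z`.) [this work] -/
theorem fiber_mono (x0 B A m τ δ : ℝ) (h0 : 0 ≤ x0) (hB : 0 ≤ B) (hA : 0 ≤ A) (hτ : 0 ≤ τ) (hδ : 0 ≤ δ) (hδm : δ ≤ m)
    (hκ : 0 ≤ (x0 + m) * τ - A * B) :
    ((x0 + m) * τ - A * B) ^ 2 * ((τ + B + δ) * (τ + A + δ) * (m - δ))
      ≤ ((x0 + m) * (τ + 2 * δ) - (A - δ) * (B - δ)) ^ 2 * ((τ + B) * (τ + A) * m) := by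
  set κ := (x0 + m) * τ - A * B with hκdef
  set κ' := (x0 + m) * (τ + 2 * δ) - (A - δ) * (B - δ) with hκ'def
  have hm : 0 ≤ m := le_trans hδ hδm
  have hp : 0 ≤ τ + B := add_nonneg hτ hB
  have hπ : 0 ≤ τ + A := add_nonneg hτ hA
  -- κ·(p+δ) ≤ κ̃·p :  κ̃p − κ(p+δ) = δ·[B(x₀+B+A+τ+m) − ... ] = δ·((p(O+B) − κ) + p(O + A − δ)) with p(O+B) − κ = B·(x₀+B+A+m+τ)
  have hAp : κ * (τ + B + δ) ≤ κ' * (τ + B) := by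
    have e : κ' * (τ + B) - κ * (τ + B + δ) = δ * (B * (x0 + B + A + m + τ) + (τ + B) * (x0 + A + (m - δ))) := by
      rw [hκdef, hκ'def]; ring
    have : 0 ≤ δ * (B * (x0 + B + A + m + τ) + (τ + B) * (x0 + A + (m - δ))) := by
      have : 0 ≤ m - δ := sub_nonneg.2 hδm
      positivity
    linarith
  have hBp : κ * (τ + A + δ) ≤ κ' * (τ + A) := by
    have e : κ' * (τ + A) - κ * (τ + A + δ) = δ * (A * (x0 + B + A + m + τ) + (τ + A) * (x0 + B + (m - δ))) := by
      rw [hκdef, hκ'def]; ring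
    have : 0 ≤ δ * (A * (x0 + B + A + m + τ) + (τ + A) * (x0 + B + (m - δ))) := by
      have : 0 ≤ m - δ := sub_nonneg.2 hδm
      positivity
    linarith
  have h1 : 0 ≤ κ * (τ + B + δ) := by positivity
  have h2 : 0 ≤ κ * (τ + A + δ) := by positivity
  have hprod : (κ * (τ + B + δ)) * (κ * (τ + A + δ)) ≤ (κ' * (τ + B)) * (κ' * (τ + A)) :=
    mul_le_mul hAp hBp h2 (le_trans h1 hAp)
  have hκ'2 : 0 ≤ κ' ^ 2 * ((τ + B) * (τ + A)) := by positivity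
  have hmδ : 0 ≤ m - δ := sub_nonneg.2 hδm
  calc κ ^ 2 * ((τ + B + δ) * (τ + A + δ) * (m - δ))
      = ((κ * (τ + B + δ)) * (κ * (τ + A + δ))) * (m - δ) := by ring
    _ ≤ ((κ' * (τ + B)) * (κ' * (τ + A))) * (m - δ) := mul_le_mul_of_nonneg_right hprod hmδ
    _ = κ' ^ 2 * ((τ + B) * (τ + A)) * (m - δ) := by ring
    _ ≤ κ' ^ 2 * ((τ + B) * (τ + A)) * m := by nlinarith
    _ = κ' ^ 2 * ((τ + B) * (τ + A) * m) := by ring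

/-- **Extremal reduction along a fibre.**  If the `Z`-raised piece `(x₀+δ, B−δ, A−δ, m−δ, τ+2δ)` (`0 ≤ δ ≤ m`) satisfies `E ≤ C`
(`κ̃² ≤ C·p̃π̃·m̃`, `C ≥ 0`) and `κ ≥ 0`, then so does `(x₀, B, A, m, τ)`.  Consequently `sup_Z` on a fibre is the only case of U(C) that
needs checking. [this work] -/
theorem fiber_le (C x0 B A m τ δ : ℝ) (hC : 0 ≤ C) (h0 : 0 ≤ x0) (hB : 0 ≤ B) (hA : 0 ≤ A) (hτ : 0 ≤ τ) (hδ : 0 ≤ δ)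
    (hδm : δ ≤ m) (hκ : 0 ≤ (x0 + m) * τ - A * B)
    (hE : ((x0 + m) * (τ + 2 * δ) - (A - δ) * (B - δ)) ^ 2 ≤ C * ((τ + B + δ) * (τ + A + δ)) * (m - δ)) :
    ((x0 + m) * τ - A * B) ^ 2 ≤ C * ((τ + B) * (τ + A)) * m := by
  have hm : 0 ≤ m := le_trans hδ hδm
  have hmδ : 0 ≤ m - δ := sub_nonneg.2 hδm
  have hN : 0 ≤ (τ + B) * (τ + A) * m := by positivity
  have hN' : 0 ≤ (τ + B + δ) * (τ + A + δ) * (m - δ) := by positivity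
  have hmono := fiber_mono x0 B A m τ δ h0 hB hA hτ hδ hδm hκ
  have hE' : ((x0 + m) * (τ + 2 * δ) - (A - δ) * (B - δ)) ^ 2 ≤ C * ((τ + B + δ) * (τ + A + δ) * (m - δ)) := by
    calc ((x0 + m) * (τ + 2 * δ) - (A - δ) * (B - δ)) ^ 2 ≤ C * ((τ + B + δ) * (τ + A + δ)) * (m - δ) := hE
      _ = C * ((τ + B + δ) * (τ + A + δ) * (m - δ)) := by ring
  rcases hN'.eq_or_lt with hz | hpos
  · -- degenerate raised piece: then `κ̃ = 0`, and `κ ≤ κ̃` forces `κ = 0`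
    have hκ'0 : ((x0 + m) * (τ + 2 * δ) - (A - δ) * (B - δ)) ^ 2 ≤ 0 := by
      rw [← hz, mul_zero] at hE'; exact hE'
    have hκ' : (x0 + m) * (τ + 2 * δ) - (A - δ) * (B - δ) = 0 :=
      (pow_eq_zero_iff two_ne_zero).mp (le_antisymm hκ'0 (sq_nonneg _))
    have hle : (x0 + m) * τ - A * B ≤ (x0 + m) * (τ + 2 * δ) - (A - δ) * (B - δ) := by
      have e : (x0 + m) * (τ + 2 * δ) - (A - δ) * (B - δ) - ((x0 + m) * τ - A * B)
          = δ * (2 * x0 + (m - δ) + m + A + B) := by ring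
      have : 0 ≤ δ * (2 * x0 + (m - δ) + m + A + B) := by positivity
      linarith
    have hκ0 : (x0 + m) * τ - A * B = 0 := le_antisymm (by linarith) hκ
    rw [hκ0]
    have : 0 ≤ C * ((τ + B) * (τ + A)) * m := by positivity
    simpa using this
  · have h2 := mul_le_mul_of_nonneg_right hE' hN
    have h3 : ((x0 + m) * τ - A * B) ^ 2 * ((τ + B + δ) * (τ + A + δ) * (m - δ))
        ≤ (C * ((τ + B) * (τ + A)) * m) * ((τ + B + δ) * (τ + A + δ) * (m - δ)) := by
      calc ((x0 + m) * τ - A * B) ^ 2 * ((τ + B + δ) * (τ + A + δ) * (m - δ))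
          ≤ ((x0 + m) * (τ + 2 * δ) - (A - δ) * (B - δ)) ^ 2 * ((τ + B) * (τ + A) * m) := hmono
        _ ≤ C * ((τ + B + δ) * (τ + A + δ) * (m - δ)) * ((τ + B) * (τ + A) * m) := h2
        _ = (C * ((τ + B) * (τ + A)) * m) * ((τ + B + δ) * (τ + A + δ) * (m - δ)) := by ring
    exact le_of_mul_le_mul_right h3 hpos

/-- **The composite of `Z`-raised pieces is the `Z`-raise of the composite** (the isolation coordinates multiply), so by
`fiber_le` + `comp_harris`: let `x = (x₀,B,A,m,τ)`, `y = (y₀,B′,A′,m′,τ′)` be valid Harris pieces, `x̃ = (x₀+δ₁, B−δ₁, A−δ₁, m−δ₁, τ+2δ₁)`,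
`ỹ` (raise by `δ₂`) valid raises; `z` = composite of `x, y` (cells `z₀,…,z_τ`), `w` = composite of `x̃, ỹ` (cells `w₀,…,w_τ`).  If `w`
has `E ≤ C` then so has `z`.  This is the TWO-SIDED EXTREMAL REDUCTION: U(C) only needs to be proved for pieces with `E = C` or with a
vanishing pendant cell (`A = 0` or `B = 0`), on both sides. [this work] -/
theorem comp_raise_le (C x0 B A m τ y0 B' A' m' τ' δ₁ δ₂ z0 zB zA zm zτ w0 wB wA wm wτ : ℝ) (hC : 0 ≤ C)
    (h0 : 0 ≤ x0) (hB : δ₁ ≤ B) (hA : δ₁ ≤ A) (hm : δ₁ ≤ m) (hτ : 0 ≤ τ) (hδ₁ : 0 ≤ δ₁)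
    (h0' : 0 ≤ y0) (hB' : δ₂ ≤ B') (hA' : δ₂ ≤ A') (hm' : δ₂ ≤ m') (hτ' : 0 ≤ τ') (hδ₂ : 0 ≤ δ₂)
    (hκ : 0 ≤ (x0 + m) * τ - A * B) (hκ' : 0 ≤ (y0 + m') * τ' - A' * B')
    (hz0 : z0 = x0 * y0) (hzB : zB = x0 * B' + B * y0 + B * B') (hzA : zA = x0 * A' + A * y0 + A * A')
    (hzm : zm = x0 * m' + m * y0 + m * m')
    (hzτ : zτ = τ * (y0 + B' + A' + m' + τ') + (x0 + B + A + m) * τ' + B * (A' + m') + A * (B' + m') + m * (B' + A'))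
    (hw0 : w0 = (x0 + δ₁) * (y0 + δ₂))
    (hwB : wB = (x0 + δ₁) * (B' - δ₂) + (B - δ₁) * (y0 + δ₂) + (B - δ₁) * (B' - δ₂))
    (hwA : wA = (x0 + δ₁) * (A' - δ₂) + (A - δ₁) * (y0 + δ₂) + (A - δ₁) * (A' - δ₂))
    (hwm : wm = (x0 + δ₁) * (m' - δ₂) + (m - δ₁) * (y0 + δ₂) + (m - δ₁) * (m' - δ₂))
    (hwτ : wτ = (τ + 2 * δ₁) * ((y0 + δ₂) + (B' - δ₂) + (A' - δ₂) + (m' - δ₂) + (τ' + 2 * δ₂))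
        + ((x0 + δ₁) + (B - δ₁) + (A - δ₁) + (m - δ₁)) * (τ' + 2 * δ₂)
        + (B - δ₁) * ((A' - δ₂) + (m' - δ₂)) + (A - δ₁) * ((B' - δ₂) + (m' - δ₂)) + (m - δ₁) * ((B' - δ₂) + (A' - δ₂)))
    (hE : ((w0 + wm) * wτ - wA * wB) ^ 2 ≤ C * ((wτ + wB) * (wτ + wA)) * wm) :
    ((z0 + zm) * zτ - zA * zB) ^ 2 ≤ C * ((zτ + zB) * (zτ + zA)) * zm := by
  have hBx : 0 ≤ B := le_trans hδ₁ hB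
  have hAx : 0 ≤ A := le_trans hδ₁ hA
  have hmx : 0 ≤ m := le_trans hδ₁ hm
  have hBy : 0 ≤ B' := le_trans hδ₂ hB'
  have hAy : 0 ≤ A' := le_trans hδ₂ hA'
  have hmy : 0 ≤ m' := le_trans hδ₂ hm'
  -- the raise parameter of the composite
  set δ := (x0 + δ₁) * (y0 + δ₂) - x0 * y0 with hδdef
  -- the raised composite IS the composite of the raised pieces (five polynomial identities)
  have e0 : w0 + wm = z0 + zm := by rw [hw0, hwm, hz0, hzm]; ring
  have eτ : wτ = zτ + 2 * δ := by rw [hwτ, hzτ, hδdef]; ring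
  have eA : wA = zA - δ := by rw [hwA, hzA, hδdef]; ring
  have eB : wB = zB - δ := by rw [hwB, hzB, hδdef]; ring
  have em : wm = zm - δ := by rw [hwm, hzm, hδdef]; ring
  have hz0n : 0 ≤ z0 := by rw [hz0]; positivity
  have hzBn : 0 ≤ zB := by rw [hzB]; positivity
  have hzAn : 0 ≤ zA := by rw [hzA]; positivity
  have hzτn : 0 ≤ zτ := by rw [hzτ]; positivity
  have hδn : 0 ≤ δ := by
    have e : δ = x0 * δ₂ + δ₁ * y0 + δ₁ * δ₂ := by rw [hδdef]; ring
    rw [e]; positivity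
  have hδzm : δ ≤ zm := by
    have hwmn : 0 ≤ wm := by
      rw [hwm]
      have := sub_nonneg.2 hm; have := sub_nonneg.2 hm'; positivity
    linarith [em]
  have hκz : 0 ≤ (z0 + zm) * zτ - zA * zB := by
    rw [hz0, hzm, hzτ, hzA, hzB]
    exact comp_harris x0 B A m τ y0 B' A' m' τ' h0 hBx hAx hmx hτ h0' hBy hAy hmy hτ' hκ hκ'
  rw [e0, eτ, eA, eB, em] at hE
  have hE' : ((z0 + zm) * (zτ + 2 * δ) - (zA - δ) * (zB - δ)) ^ 2 ≤ C * ((zτ + zB + δ) * (zτ + zA + δ)) * (zm - δ) := by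
    have e2 : zτ + zB + δ = zτ + 2 * δ + (zB - δ) := by ring
    have e3 : zτ + zA + δ = zτ + 2 * δ + (zA - δ) := by ring
    rw [e2, e3]; exact hE
  exact fiber_le C z0 zB zA zm zτ δ hC hz0n hzBn hzAn hzτn hδn hδzm hκz hE'

end APL

end Summit.CriticalPhenomena.PercolationContinuityZ3.Theorems
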